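import Literature.AlgebraicGeometry.GroupSchemes.ClosedSubgroupDichotomyOfPointCount   -- ★ (E-b) p845148: `etale_of_natCard_hom_eq_finrank`, `natCard_hom_eq_natCard_range`, `isFinite_hom_of_isClosedImmersion` (+ μ3, (o-c2d))
import Literature.AlgebraicGeometry.GroupSchemes.ConnectedLayerClosedSubgroups           -- ★ (o-c3m) p845089∕p845110: `exists_iso_of_finrank_alg_eq` (+ (o-c3m-a) ideal of a closed subgroup)
import HarnessLib

/-!
# The dichotomy for stable closed subgroups of a finite group scheme over `k̄`, in HOPF-IDEAL currency, uniform in the ordinary ∕ supersingular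
# point count ([Tate 1997] (3.7); [HarrisTaylorAMS2001] Lemma II.2.1)

Topic `Literature/AlgebraicGeometry/GroupSchemes`; namespace `Literature.AlgebraicGeometry.GroupSchemes`.  THEOREMS ONLY (no definition, no named fact,
no instance, no notation, no `sorry`).  Cell `hodgecm-mathlib`, P6 «MOD programme», DICT constructor organ **(K-b) «DICHOTOMY-HOPF»** (desk F0P6c-plan
(g2) 15:45:46Z): the (b)-currency face of ★ (E-b) `ClosedSubgroupDichotomyOfPointCount` with the CONNECTED half made UNIFORM in the ordinary
(`#G(k̄) = q`) and supersingular (`#G(k̄) = 1`) cases by comparison, inside the MONOGENIC unit component `G₀ ≅ Spec k[X]⧸(X^{p^N})` (★ (o-c3m)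
currency), with a REFERENCE subgroup `K` of the same rank (print: `K = ker F`).  Generic, count-neutral capital `--supports stmt-HodgeConjecture-24832`.
HONEST LABEL: HC_CM is proved only modulo the printed citations until rung 0 closes; this file pays no letter.

Setting: `k` algebraically closed of characteristic `p`; `G` a finite group scheme over `k` with unit component `j : G₀ ↪ G` (P6b clause
`IsMonHom j ∧ IsOpenImmersion j.left ∧ IsClosedImmersion j.left ∧ ConnectedSpace G₀.left`) and `θ : k[X]⧸(X^{p^N}) ≃ₐ[k] Γ(G₀)`; endomorphisms
`β i : G ⟶ G` acting on `G(k) = (𝟙_ ⟶ G)` with no stable subgroup other than `⊥`, `⊤` (`hsimple`); `#G(k) = 1 ∨ #G(k) = q` (`hG`).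

* §1 `exists_iso_comp_eq_or_etale_of_stable_of_monogenic` — SUBGROUP-SCHEME form: for a reference closed subgroup `κ₀ : Kc ↪ G₀` of rank `q` and a
  `β`-stable closed subgroup `c : H ↪ G` of rank `q`: EITHER `H ≅ Kc` over `G` OR `H → Spec k` is ÉTALE.  (The image of `H(k)` in `G(k)` is `⊥`
  or `⊤`; one point ⇒ `H` connected (μ3 ★ `connectedSpace_left_of_natCard_hom_eq_one`) ⇒ `H ↪ G₀` (★ (o-c2d) `existsUnique_fac_hom`) ⇒ equal
  rank inside the monogenic `G₀` forces `H ≅ Kc` (★ (o-c3m) `exists_iso_of_finrank_alg_eq`); `q` points ⇒ étale (★ (E-b-ét)).)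
* §2 HEAD **`eq_or_etale_of_isHopfIdeal_of_stable`** — HOPF-IDEAL form: `K`, `I` Hopf ideals of `Γ(G)` of corank `q`, `K ⊇` the ideal of `G₀`,
  `V(I)` `β`-stable (`quotIncl G I ≫ β i` factors through `quotIncl G I`); THEN `I = K ∨ Etale (Spec (Γ(G)⧸I) → Spec k)` (★ `quotIncl`,
  `exists_grpObj_isMonHom_quotIncl`, `ker_ptEquiv_isoSpecOver_inv_comp_quotIncl`, points criteria); `…_of_le_ker` — the same with stability as
  the ideal inequality `I ≤ ker (alg. map of quotIncl G I ≫ β i)`.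

## References
* [Tate1997FiniteFlatGroupSchemes] J. Tate, *Finite flat group schemes* (1997), (3.7), p. 141 (`rank G = #G(k̄) · rank G⁰`; connected ⇔ one point;
  a connected closed subgroup lies in `G⁰`).
* [HarrisTaylorAMS2001] M. Harris, R. Taylor, *The geometry and cohomology of some simple Shimura varieties* (2001), Lemma II.2.1 (closed subgroups
  of a one-dimensional layer are the `ker F^j`).
* [GortzWedhorn2023] U. Görtz, T. Wedhorn, *Algebraic Geometry II* (2023), §(27.2) (27.2.1), p. 607 (closed subgroup schemes ↔ Hopf ideals).
-/

set_option autoImplicit false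

-- Mathlib's `Over`/`Scheme` APIs are stated across semireducible wrappers (as in the ★ `GroupSchemes/*` files).
set_option backward.isDefEq.respectTransparency false

noncomputable section

universe u

open CategoryTheory CategoryTheory.Limits AlgebraicGeometry MonoidalCategory CartesianMonoidalCategory Polynomial
open scoped MonObj

namespace Literature.AlgebraicGeometry.GroupSchemes

open Literature.AlgebraicGeometry.Motives AffineGroupScheme

variable {k : Type u} [Field k] [IsAlgClosed k] {p : ℕ} [hp : Fact p.Prime] [CharP k p]

/-! ## §1 Subgroup-scheme form: `β`-stable closed subgroups of rank `q` are `≅` the reference subgroup of `G₀`, or étale -/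

/-- **DICHOTOMY, SUBGROUP-SCHEME FORM, UNIFORM IN THE POINT COUNT.**  `k = k̄` of characteristic `p`; `G` finite over `k` with unit component
`j : G₀ ↪ G`, `G₀` MONOGENIC (`θ : k[X]⧸(X^{p^N}) ≃ₐ Γ(G₀)`); `κ₀ : Kc ↪ G₀` a reference closed subgroup of rank `q`; `β i : G ⟶ G` with `G(k)`
`β`-simple; `#G(k) ∈ {1, q}`; `c : H ↪ G` a closed subgroup of rank `q` whose points are `β`-stable.  THEN `H ≅ Kc` over `G`, OR `H` is étale.
[cite: Tate1997FiniteFlatGroupSchemes, (3.7)] [cite: HarrisTaylorAMS2001, Lemma II.2.1] -/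
theorem exists_iso_comp_eq_or_etale_of_stable_of_monogenic {G G₀ H Kc : Over (Spec (.of k))} [GrpObj G] [GrpObj G₀] [GrpObj H] [GrpObj Kc]
    [IsFinite G.hom] [IsAffine G₀.left] [IsAffine H.left] [IsAffine Kc.left]
    (j : G₀ ⟶ G) (hj : IsMonHom j ∧ IsOpenImmersion j.left ∧ IsClosedImmersion j.left ∧ ConnectedSpace ↥G₀.left)
    {N : ℕ} (θ : (k[X] ⧸ Ideal.span {(X : k[X]) ^ (p ^ N)}) ≃ₐ[k] Alg G₀)
    (κ₀ : Kc ⟶ G₀) [IsMonHom κ₀] [IsClosedImmersion κ₀.left]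
    (c : H ⟶ G) [IsMonHom c] [IsClosedImmersion c.left]
    {σ : Type*} (β : σ → (G ⟶ G))
    (hsimple : ∀ S : Subgroup (𝟙_ (Over (Spec (.of k))) ⟶ G), (∀ i, ∀ g ∈ S, g ≫ β i ∈ S) → S = ⊥ ∨ S = ⊤)
    (hstab : ∀ (i : σ) (h : 𝟙_ (Over (Spec (.of k))) ⟶ H), ∃ h' : 𝟙_ (Over (Spec (.of k))) ⟶ H, h' ≫ c = (h ≫ c) ≫ β i)
    {q : ℕ} (hG : Nat.card (𝟙_ (Over (Spec (.of k))) ⟶ G) = 1 ∨ Nat.card (𝟙_ (Over (Spec (.of k))) ⟶ G) = q)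
    (hKc : Module.finrank k (Alg Kc) = q) (hH : Module.finrank k (Alg H) = q) :
    (∃ e : H ≅ Kc, e.hom ≫ κ₀ ≫ j = c) ∨ Etale H.hom := by
  obtain ⟨hmon, hop, hcl, hconn⟩ := hj
  haveI := hmon; haveI := hop; haveI := hcl; haveI := hconn
  haveI : IsFinite H.hom := isFinite_hom_of_isClosedImmersion c
  -- the image of `H(k)` in `G(k)` is a `β`-stable subgroup, hence `⊥` or `⊤`
  let f : (𝟙_ (Over (Spec (.of k))) ⟶ H) →* (𝟙_ (Over (Spec (.of k))) ⟶ G) :=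
    MonoidHom.mk' (fun h => h ≫ c) (fun a b => MonObj.mul_comp a b c)
  have hS : ∀ i, ∀ g ∈ f.range, g ≫ β i ∈ f.range := by
    rintro i _ ⟨h, rfl⟩
    obtain ⟨h', hh'⟩ := hstab i h
    exact ⟨h', hh'⟩
  have hcard : Nat.card (𝟙_ (Over (Spec (.of k))) ⟶ H) = Nat.card f.range := natCard_hom_eq_natCard_range c
  have key : Nat.card (𝟙_ (Over (Spec (.of k))) ⟶ H) = 1 ∨
      Nat.card (𝟙_ (Over (Spec (.of k))) ⟶ H) = Module.finrank k (Alg H) := by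
    rcases hsimple f.range hS with hbot | htop
    · left
      rwa [hbot, Subgroup.card_bot] at hcard
    · rw [htop, Subgroup.card_top] at hcard
      rcases hG with h1 | hq
      · left
        rw [hcard, h1]
      · right
        rw [hcard, hq, hH]
  rcases key with h1 | hq
  · -- ONE POINT: `H` is connected, lies in `G₀`, and has the rank of `Kc` inside the monogenic `G₀`
    left
    haveI : ConnectedSpace ↥H.left := connectedSpace_left_of_natCard_hom_eq_one k H inferInstance h1
    haveI : Nonempty ↥(𝟙_ (Over (Spec (.of k)))).left := inferInstanceAs (Nonempty (PrimeSpectrum k))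
    obtain ⟨h₀, hh₀, -⟩ := existsUnique_fac_hom j c
    haveI : IsClosedImmersion (h₀.left ≫ j.left) := by rw [← Over.comp_left, hh₀]; infer_instance
    haveI : IsClosedImmersion h₀.left := IsClosedImmersion.of_comp_isClosedImmersion h₀.left j.left
    haveI : Mono j := Over.mono_of_mono_left j
    haveI : IsMonHom (h₀ ≫ j) := by rw [hh₀]; infer_instance
    haveI : IsMonHom h₀ := isMonHom_of_comp j h₀
    obtain ⟨e, he⟩ := exists_iso_of_finrank_alg_eq θ h₀ κ₀ (hH.trans hKc.symm)
    exact ⟨e, by rw [← Category.assoc, he, hh₀]⟩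
  · -- `q` POINTS: étale
    right
    exact etale_of_natCard_hom_eq_finrank H hq

/-! ## §2 HEAD: Hopf-ideal form -/

/-- **(K-b) DICHOTOMY IN HOPF-IDEAL CURRENCY.**  `k = k̄` of characteristic `p`; `G` a finite group scheme over `k` (affine) with unit component
`j : G₀ ↪ G`, `G₀` MONOGENIC (`θ : k[X]⧸(X^{p^N}) ≃ₐ[k] Γ(G₀)`); `β i : G ⟶ G` with `G(k)` `β`-simple; `#G(k) = 1 ∨ #G(k) = q` (supersingular ∕
ordinary); `K ⊆ Γ(G)` a Hopf ideal of corank `q` CONTAINING THE IDEAL OF `G₀` (print: `K` cuts out `ker F ⊆ G⁰`); `I ⊆ Γ(G)` a Hopf ideal of corank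
`q` whose closed subgroup scheme `V(I) = Spec (Γ(G)⧸I) ↪ G` is `β`-STABLE.  THEN `I = K`, OR `Spec (Γ(G)⧸I) → Spec k` is ÉTALE.
[cite: Tate1997FiniteFlatGroupSchemes, (3.7)] [cite: HarrisTaylorAMS2001, Lemma II.2.1] [cite: GortzWedhorn2023, §(27.2) (27.2.1) (p. 607)] -/
theorem eq_or_etale_of_isHopfIdeal_of_stable {G G₀ : Over (Spec (.of k))} [GrpObj G] [GrpObj G₀] [IsFinite G.hom] [IsAffine G.left]
    [IsAffine G₀.left]
    (j : G₀ ⟶ G) (hj : IsMonHom j ∧ IsOpenImmersion j.left ∧ IsClosedImmersion j.left ∧ ConnectedSpace ↥G₀.left)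
    {N : ℕ} (θ : (k[X] ⧸ Ideal.span {(X : k[X]) ^ (p ^ N)}) ≃ₐ[k] Alg G₀)
    {σ : Type*} (β : σ → (G ⟶ G))
    (hsimple : ∀ S : Subgroup (𝟙_ (Over (Spec (.of k))) ⟶ G), (∀ i, ∀ g ∈ S, g ≫ β i ∈ S) → S = ⊥ ∨ S = ⊤)
    {q : ℕ} (hG : Nat.card (𝟙_ (Over (Spec (.of k))) ⟶ G) = 1 ∨ Nat.card (𝟙_ (Over (Spec (.of k))) ⟶ G) = q)
    (K : Ideal (Alg G)) [K.IsHopfIdeal k]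
    (hK₀ : RingHom.ker (ptEquiv G (Alg G₀) ((isoSpecOver G₀).inv ≫ j)).toRingHom ≤ K) (hKq : Module.finrank k (Alg G ⧸ K) = q)
    (I : Ideal (Alg G)) [I.IsHopfIdeal k] (hIq : Module.finrank k (Alg G ⧸ I) = q)
    (hstab : ∀ i : σ, ∃ v : Literature.AlgebraicGeometry.Motives.specOver k (Alg G ⧸ I) ⟶ Literature.AlgebraicGeometry.Motives.specOver k (Alg G ⧸ I), v ≫ quotIncl G I = quotIncl G I ≫ β i) :
    I = K ∨ Etale (Literature.AlgebraicGeometry.Motives.specOver k (Alg G ⧸ I)).hom := by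
  obtain ⟨hmon, hop, hcl, hconn⟩ := hj
  haveI := hmon; haveI := hop; haveI := hcl; haveI := hconn
  -- the closed subgroup schemes `V(I)`, `V(K)` of `G`
  obtain ⟨instI, hmonI⟩ := exists_grpObj_isMonHom_quotIncl G I
  letI := instI
  haveI : IsMonHom (quotIncl G I) := hmonI
  obtain ⟨instK, hmonK⟩ := exists_grpObj_isMonHom_quotIncl G K
  letI := instK
  haveI : IsMonHom (quotIncl G K) := hmonK
  haveI : IsClosedImmersion (quotIncl G I).left := isClosedImmersion_quotIncl_left G I
  haveI : IsClosedImmersion (quotIncl G K).left := isClosedImmersion_quotIncl_left G K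
  haveI : IsAffine (Literature.AlgebraicGeometry.Motives.specOver k (Alg G ⧸ I)).left :=
    inferInstanceAs (IsAffine (Spec (CommRingCat.of (Alg G ⧸ I))))
  haveI : IsAffine (Literature.AlgebraicGeometry.Motives.specOver k (Alg G ⧸ K)).left :=
    inferInstanceAs (IsAffine (Spec (CommRingCat.of (Alg G ⧸ K))))
  -- `V(K) ⊆ G₀`: its tautological point kills the ideal of `G₀`
  obtain ⟨v, hv⟩ := (exists_comp_eq_iff_le_ker j ((isoSpecOver (Literature.AlgebraicGeometry.Motives.specOver k (Alg G ⧸ K))).inv ≫ quotIncl G K)).mpr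
    (by rw [ker_ptEquiv_isoSpecOver_inv_comp_quotIncl]; exact hK₀)
  let κ₀ : Literature.AlgebraicGeometry.Motives.specOver k (Alg G ⧸ K) ⟶ G₀ := (isoSpecOver (Literature.AlgebraicGeometry.Motives.specOver k (Alg G ⧸ K))).hom ≫ v
  have hκ₀ : κ₀ ≫ j = quotIncl G K := by rw [Category.assoc, hv, Iso.hom_inv_id_assoc]
  haveI : IsClosedImmersion (κ₀.left ≫ j.left) := by rw [← Over.comp_left, hκ₀]; infer_instance
  haveI : IsClosedImmersion κ₀.left := IsClosedImmersion.of_comp_isClosedImmersion κ₀.left j.left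
  haveI : Mono j := Over.mono_of_mono_left j
  haveI : IsMonHom (κ₀ ≫ j) := by rw [hκ₀]; infer_instance
  haveI : IsMonHom κ₀ := isMonHom_of_comp j κ₀
  -- ranks of `V(I)`, `V(K)` (`Γ(G) ⧸ I ≃ₐ Γ(V(I))`)
  have hrk : ∀ (J : Ideal (Alg G)) [J.IsTwoSided] [IsAffine (Literature.AlgebraicGeometry.Motives.specOver k (Alg G ⧸ J)).left], Module.finrank k (Alg G ⧸ J) = q →
      Module.finrank k (Alg (Literature.AlgebraicGeometry.Motives.specOver k (Alg G ⧸ J))) = q := by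
    intro J _ _ hJ
    haveI : IsClosedImmersion (quotIncl G J).left := isClosedImmersion_quotIncl_left G J
    obtain ⟨e, -⟩ := exists_algEquiv_quotient_ker (quotIncl G J)
    rw [← e.toLinearEquiv.finrank_eq, (Ideal.quotientEquivAlgOfEq k (ker_ptEquiv_isoSpecOver_inv_comp_quotIncl G J)).toLinearEquiv.finrank_eq,
      hJ]
  -- points of `V(I)` are `β`-stable
  have hstab' : ∀ (i : σ) (h : 𝟙_ (Over (Spec (.of k))) ⟶ Literature.AlgebraicGeometry.Motives.specOver k (Alg G ⧸ I)),
      ∃ h' : 𝟙_ (Over (Spec (.of k))) ⟶ Literature.AlgebraicGeometry.Motives.specOver k (Alg G ⧸ I), h' ≫ quotIncl G I = (h ≫ quotIncl G I) ≫ β i := by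
    intro i h
    obtain ⟨w, hw⟩ := hstab i
    exact ⟨h ≫ w, by rw [Category.assoc, hw, Category.assoc]⟩
  rcases exists_iso_comp_eq_or_etale_of_stable_of_monogenic j ⟨hmon, hop, hcl, hconn⟩ θ κ₀ (quotIncl G I) β hsimple hstab' hG
      (hrk K hKq) (hrk I hIq) with ⟨e, he⟩ | het
  · -- `V(I) ≅ V(K)` over `G`: the two ideals coincide (points criterion at the tautological points)
    left
    rw [hκ₀] at he
    apply le_antisymm
    · -- `I ≤ K`: the tautological point of `V(K)` factors through `V(I)` by `e.inv`
      have h := (exists_comp_eq_iff_le_ker (quotIncl G I) ((isoSpecOver (Literature.AlgebraicGeometry.Motives.specOver k (Alg G ⧸ K))).inv ≫ quotIncl G K)).mp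
        ⟨(isoSpecOver (Literature.AlgebraicGeometry.Motives.specOver k (Alg G ⧸ K))).inv ≫ e.inv, by rw [Category.assoc, ← he, e.inv_hom_id_assoc]⟩
      rwa [ker_ptEquiv_isoSpecOver_inv_comp_quotIncl, ker_ptEquiv_isoSpecOver_inv_comp_quotIncl] at h
    · -- `K ≤ I`: the tautological point of `V(I)` factors through `V(K)` by `e.hom`
      have h := (exists_comp_eq_iff_le_ker (quotIncl G K) ((isoSpecOver (Literature.AlgebraicGeometry.Motives.specOver k (Alg G ⧸ I))).inv ≫ quotIncl G I)).mp
        ⟨(isoSpecOver (Literature.AlgebraicGeometry.Motives.specOver k (Alg G ⧸ I))).inv ≫ e.hom, by rw [Category.assoc, he]⟩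
      rwa [ker_ptEquiv_isoSpecOver_inv_comp_quotIncl, ker_ptEquiv_isoSpecOver_inv_comp_quotIncl] at h
  · right
    exact het

/-- **(K-b), stability as an IDEAL INEQUALITY**: the same with `V(I)` `β`-stable in the form `I ≤ ker (algebra map of quotIncl G I ≫ β i)` (★ points
criterion `exists_comp_quotIncl_eq_iff_le_ker`). [cite: Tate1997FiniteFlatGroupSchemes, (3.7)] [cite: GortzWedhorn2023, §(27.2) (27.2.1) (p. 607)] -/
theorem eq_or_etale_of_isHopfIdeal_of_le_ker {G G₀ : Over (Spec (.of k))} [GrpObj G] [GrpObj G₀] [IsFinite G.hom] [IsAffine G.left]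
    [IsAffine G₀.left]
    (j : G₀ ⟶ G) (hj : IsMonHom j ∧ IsOpenImmersion j.left ∧ IsClosedImmersion j.left ∧ ConnectedSpace ↥G₀.left)
    {N : ℕ} (θ : (k[X] ⧸ Ideal.span {(X : k[X]) ^ (p ^ N)}) ≃ₐ[k] Alg G₀)
    {σ : Type*} (β : σ → (G ⟶ G))
    (hsimple : ∀ S : Subgroup (𝟙_ (Over (Spec (.of k))) ⟶ G), (∀ i, ∀ g ∈ S, g ≫ β i ∈ S) → S = ⊥ ∨ S = ⊤)
    {q : ℕ} (hG : Nat.card (𝟙_ (Over (Spec (.of k))) ⟶ G) = 1 ∨ Nat.card (𝟙_ (Over (Spec (.of k))) ⟶ G) = q)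
    (K : Ideal (Alg G)) [K.IsHopfIdeal k]
    (hK₀ : RingHom.ker (ptEquiv G (Alg G₀) ((isoSpecOver G₀).inv ≫ j)).toRingHom ≤ K) (hKq : Module.finrank k (Alg G ⧸ K) = q)
    (I : Ideal (Alg G)) [I.IsHopfIdeal k] (hIq : Module.finrank k (Alg G ⧸ I) = q)
    (hstab : ∀ i : σ, I ≤ RingHom.ker (ptEquiv G (Alg G ⧸ I) (quotIncl G I ≫ β i)).toRingHom) :
    I = K ∨ Etale (Literature.AlgebraicGeometry.Motives.specOver k (Alg G ⧸ I)).hom :=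
  eq_or_etale_of_isHopfIdeal_of_stable j hj θ β hsimple hG K hK₀ hKq I hIq
    fun i => (exists_comp_quotIncl_eq_iff_le_ker G I (quotIncl G I ≫ β i)).mpr (hstab i)

end Literature.AlgebraicGeometry.GroupSchemes

end
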